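import Mathlib

/-!
# NE7EJResolventTransport — row NE7 (node U5), candidate route HOM, variant H1L-EJ, item EJ-1b′ (T1)–(T3′): the RESOLVENT PUSH-THROUGH
# `C(c + CᵀC)⁻¹ = (c + CCᵀ)⁻¹C` and lens 1's THEOREM B equivalence «EF ≥ Hess²(2+Hess)⁻¹ ⇔ 4AᵀA ≤ 2(2+K)⁻¹ on ran C» for ARBITRARY real
# matrices (`Hess = CᵀC`, `K = CCᵀ`, `EF = Cᵀ(1 − 4AᵀA)C`) — the rational-function companion of file 119's polynomial transport

Lineage `b2b-balaban-t4-ne7-p2` (CRUX PROVER NE7 #2 = C-HOM°'s kernel hand), generation 82; file 133.  Mathlib-only imports.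

SOURCE (lens 1 = `t4-ne7-idea-1`; gen 67 `DEFECT-VS-HESSIAN-NOTE.md` 9e7cf2b6f8adbc99 §1 (A2) «EF^flat ≥ φ(Hess^flat) on phys ⇔ 4A†A ≤ g(−Δ_plaq) … (push
Cᵀψ(CCᵀ)C = φ(CᵀC), φ = xψ)», typed for POLYNOMIAL ψ in file 119 `NE7EJFlatTransport` (`mul_aeval_transpose_mul`, `transport_iff`); gen 73 THEOREM B
«EF^flat ≥ Hess²(2+Hess)⁻¹ ⇔ 4A†A ≤ 2(2−Δ_plaq)⁻¹» uses the RATIONAL profile `φ_B(x) = x²∕(2+x)`, `ψ_B = x∕(2+x)`, `g_B = 1 − ψ_B = 2∕(2+x)`; d = 2,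
L = 2 FLAT abelian toy — «never the NE7 estimate»).  Files 129–131 realise `ψ_B(K)` on the torus as a Fourier multiplier; THIS FILE is the
matrix-algebra statement behind the words «= Hess²(2+Hess)⁻¹», for any real `C : m × n`, `A : k × m` and `c > 0`:
* §1 `gramN c C := c•1 + CᵀC`, `gramM c C := c•1 + CCᵀ`; **`mulVec_gramN_injective`** ∕ `isUnit_gramN` ∕ `isUnit_gramM` (positive `c` ⇒ invertible,
  by `c‖v‖² + ‖Cv‖² = 0 ⇒ v = 0`); **`push_through`** (`C·(gramN)⁻¹ = (gramM)⁻¹·C`); `one_sub_smul_inv_gramM` (`1 − c(gramM)⁻¹ = CCᵀ(gramM)⁻¹`).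
* §2 **`hessSq_mul_inv_eq`** (`(CᵀC)²(gramN)⁻¹ = Cᵀ[(CCᵀ)(gramM)⁻¹]C`) and the form identity **`form_hessSq_inv`** (`⟨v, (CᵀC)²(c+CᵀC)⁻¹v⟩ =
  ⟨Cv, K(c+K)⁻¹Cv⟩`, `K = CCᵀ`).
* §3 THEOREM B's transport, both directions: **`transportB_of_block`** (`∀ u, 4‖Au‖² ≤ ⟨u, c(gramM)⁻¹u⟩` ⇒ `∀ v, ⟨v, (CᵀC)²(gramN)⁻¹v⟩ ≤ ‖Cv‖² −
  4‖ACv‖²`) and **`block_of_transportB`** (the converse ON `ran C`), packaged as `transportB_iff` — at `c = 2` this is her displayed equivalence.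

HONEST FRAMING: [folklore] finite-dimensional real matrix algebra (no analysis); lens 1's objects stay hers; nothing of Bałaban's instantiated; the torus
instance (`C = d` on 1-forms of `(ℤ∕2N)²`) is files 122 ∕ 125 ∕ 131, not re-done here; NOT a letter move (PRICING-NE7 v56 §413: toy rungs at zero letter);
T-50-10 honoured.  NE7 NOT PRINTED ∕ NOT PROVED; spine 0∕9; FIXED FINITE T⁴, rung (B)+1; NOT infinite volume, NOT mass gap, NOT Clay.  HONEST DEPENDENCY:
continuum YM on T⁴ ⇐ BetaPertH ∧ nine spine estimates (0/9 proved); BetaPertH ⇐ (D1) ∧ (D4) ∧ CAP+tail; G-an2-4 gates asym, D1 and NE2/3/4.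
-/

noncomputable section

open Matrix

namespace Summit.QuantumFields.BalabanUV.T4Continuum.NE7EJResolventTransport

variable {m n k : Type*} [Fintype m] [Fintype n] [Fintype k] [DecidableEq m] [DecidableEq n]

/-! ### §1 The two Gram resolvents and the push-through identity -/

/-- `gramN c C := c•1 + CᵀC` (`= c + Hess`). [folklore] -/
def gramN (c : ℝ) (C : Matrix m n ℝ) : Matrix n n ℝ := c • (1 : Matrix n n ℝ) + Cᵀ * C

/-- `gramM c C := c•1 + CCᵀ` (`= c + K`). [folklore] -/
def gramM (c : ℝ) (C : Matrix m n ℝ) : Matrix m m ℝ := c • (1 : Matrix m m ℝ) + C * Cᵀ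

/-- the intertwining relation `(c + CCᵀ)·C = C·(c + CᵀC)`. [folklore] -/
theorem gramM_mul_eq_mul_gramN (c : ℝ) (C : Matrix m n ℝ) : gramM c C * C = C * gramN c C := by
  unfold gramM gramN
  rw [Matrix.add_mul, Matrix.mul_add, Matrix.smul_mul, Matrix.mul_smul, Matrix.one_mul, Matrix.mul_one, Matrix.mul_assoc]

omit [DecidableEq m] in
/-- the quadratic form of `c + CᵀC`: `⟨v, (c + CᵀC)v⟩ = c‖v‖² + ‖Cv‖²`. [folklore] -/
theorem form_gramN (c : ℝ) (C : Matrix m n ℝ) (v : n → ℝ) :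
    v ⬝ᵥ (gramN c C *ᵥ v) = c * (v ⬝ᵥ v) + (C *ᵥ v) ⬝ᵥ (C *ᵥ v) := by
  unfold gramN
  rw [Matrix.add_mulVec, dotProduct_add, Matrix.smul_mulVec, Matrix.one_mulVec, dotProduct_smul, smul_eq_mul,
    ← Matrix.mulVec_mulVec, Matrix.dotProduct_mulVec, Matrix.vecMul_transpose]

omit [DecidableEq m] in
/-- **`c + CᵀC` is injective for `c > 0`.** [folklore] -/
theorem mulVec_gramN_injective {c : ℝ} (hc : 0 < c) (C : Matrix m n ℝ) : Function.Injective (gramN c C).mulVec := by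
  intro v w h
  have h0 : gramN c C *ᵥ (v - w) = 0 := by rw [Matrix.mulVec_sub, h, sub_self]
  have hf := form_gramN c C (v - w)
  rw [h0, dotProduct_zero] at hf
  have h1 : 0 ≤ (C *ᵥ (v - w)) ⬝ᵥ (C *ᵥ (v - w)) := Finset.sum_nonneg fun i _ => mul_self_nonneg _
  have h2 : 0 ≤ (v - w) ⬝ᵥ (v - w) := Finset.sum_nonneg fun i _ => mul_self_nonneg _
  have h3 : (v - w) ⬝ᵥ (v - w) = 0 := by nlinarith [mul_nonneg hc.le h2]
  exact sub_eq_zero.mp (dotProduct_self_eq_zero.mp h3)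

omit [DecidableEq m] in
/-- hence `c + CᵀC` is invertible (`c > 0`). [folklore] -/
theorem isUnit_gramN {c : ℝ} (hc : 0 < c) (C : Matrix m n ℝ) : IsUnit (gramN c C) :=
  Matrix.mulVec_injective_iff_isUnit.mp (mulVec_gramN_injective hc C)

omit [DecidableEq n] in
/-- and so is `c + CCᵀ` (the same statement for `Cᵀ`). [folklore] -/
theorem isUnit_gramM {c : ℝ} (hc : 0 < c) (C : Matrix m n ℝ) : IsUnit (gramM c C) := by
  have h := isUnit_gramN hc Cᵀ
  unfold gramN at h; unfold gramM
  rwa [Matrix.transpose_transpose] at h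

omit [DecidableEq m] in
/-- the determinant form of invertibility. [folklore] -/
theorem isUnit_det_gramN {c : ℝ} (hc : 0 < c) (C : Matrix m n ℝ) : IsUnit (gramN c C).det :=
  (Matrix.isUnit_iff_isUnit_det _).mp (isUnit_gramN hc C)

omit [DecidableEq n] in
/-- the determinant form for `gramM`. [folklore] -/
theorem isUnit_det_gramM {c : ℝ} (hc : 0 < c) (C : Matrix m n ℝ) : IsUnit (gramM c C).det :=
  (Matrix.isUnit_iff_isUnit_det _).mp (isUnit_gramM hc C)

/-- **PUSH-THROUGH**: `C·(c + CᵀC)⁻¹ = (c + CCᵀ)⁻¹·C` for `c > 0`. [folklore] -/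
theorem push_through {c : ℝ} (hc : 0 < c) (C : Matrix m n ℝ) : C * (gramN c C)⁻¹ = (gramM c C)⁻¹ * C := by
  have hN := isUnit_det_gramN hc C
  have hM := isUnit_det_gramM hc C
  calc C * (gramN c C)⁻¹ = ((gramM c C)⁻¹ * gramM c C) * C * (gramN c C)⁻¹ := by rw [Matrix.nonsing_inv_mul _ hM, Matrix.one_mul]
    _ = (gramM c C)⁻¹ * (gramM c C * C) * (gramN c C)⁻¹ := by rw [Matrix.mul_assoc (gramM c C)⁻¹]
    _ = (gramM c C)⁻¹ * (C * gramN c C) * (gramN c C)⁻¹ := by rw [gramM_mul_eq_mul_gramN]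
    _ = (gramM c C)⁻¹ * C * (gramN c C * (gramN c C)⁻¹) := by
          rw [← Matrix.mul_assoc (gramM c C)⁻¹, Matrix.mul_assoc ((gramM c C)⁻¹ * C)]
    _ = (gramM c C)⁻¹ * C := by rw [Matrix.mul_nonsing_inv _ hN, Matrix.mul_one]

omit [DecidableEq n] in
/-- `1 − c·(c + CCᵀ)⁻¹ = CCᵀ·(c + CCᵀ)⁻¹` — the weight identity `1 − g_B(K) = ψ_B(K)` (`c = 2`). [folklore] -/
theorem one_sub_smul_inv_gramM {c : ℝ} (hc : 0 < c) (C : Matrix m n ℝ) :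
    (1 : Matrix m m ℝ) - c • (gramM c C)⁻¹ = (C * Cᵀ) * (gramM c C)⁻¹ := by
  have hM := isUnit_det_gramM hc C
  have h : gramM c C * (gramM c C)⁻¹ = 1 := Matrix.mul_nonsing_inv _ hM
  have e : C * Cᵀ = gramM c C - c • (1 : Matrix m m ℝ) := by unfold gramM; abel
  rw [e, Matrix.sub_mul, h, Matrix.smul_mul, Matrix.one_mul]

omit [DecidableEq m] in
/-- the same on the `n` side: `1 − c·(c + CᵀC)⁻¹ = CᵀC·(c + CᵀC)⁻¹`. [folklore] -/
theorem one_sub_smul_inv_gramN {c : ℝ} (hc : 0 < c) (C : Matrix m n ℝ) :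
    (1 : Matrix n n ℝ) - c • (gramN c C)⁻¹ = (Cᵀ * C) * (gramN c C)⁻¹ := by
  have hN := isUnit_det_gramN hc C
  have h : gramN c C * (gramN c C)⁻¹ = 1 := Matrix.mul_nonsing_inv _ hN
  have e : Cᵀ * C = gramN c C - c • (1 : Matrix n n ℝ) := by unfold gramN; abel
  rw [e, Matrix.sub_mul, h, Matrix.smul_mul, Matrix.one_mul]

/-! ### §2 `Hess²(c + Hess)⁻¹ = Cᵀ·K(c + K)⁻¹·C` -/

/-- **`(CᵀC)²(c + CᵀC)⁻¹ = Cᵀ[(CCᵀ)(c + CCᵀ)⁻¹]C`** (`Hess²(c+Hess)⁻¹ = Cᵀψ(K)C`, `ψ(x) = x∕(c+x)`). [folklore] -/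
theorem hessSq_mul_inv_eq {c : ℝ} (hc : 0 < c) (C : Matrix m n ℝ) :
    (Cᵀ * C) * (Cᵀ * C) * (gramN c C)⁻¹ = Cᵀ * ((C * Cᵀ) * (gramM c C)⁻¹) * C := by
  calc (Cᵀ * C) * (Cᵀ * C) * (gramN c C)⁻¹ = Cᵀ * (C * Cᵀ) * (C * (gramN c C)⁻¹) := by
          simp only [Matrix.mul_assoc]
    _ = Cᵀ * (C * Cᵀ) * ((gramM c C)⁻¹ * C) := by rw [push_through hc]
    _ = Cᵀ * ((C * Cᵀ) * (gramM c C)⁻¹) * C := by simp only [Matrix.mul_assoc]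

omit [DecidableEq m] [DecidableEq n] in
/-- forms transport through `Cᵀ … C`: `⟨v, (CᵀXC)v⟩ = ⟨Cv, X(Cv)⟩`. [folklore] -/
theorem form_conj (X : Matrix m m ℝ) (C : Matrix m n ℝ) (v : n → ℝ) :
    v ⬝ᵥ ((Cᵀ * X * C) *ᵥ v) = (C *ᵥ v) ⬝ᵥ (X *ᵥ (C *ᵥ v)) := by
  rw [← Matrix.mulVec_mulVec, ← Matrix.mulVec_mulVec, Matrix.dotProduct_mulVec v Cᵀ, Matrix.vecMul_transpose]

/-- **THE FORM IDENTITY**: `⟨v, (CᵀC)²(c + CᵀC)⁻¹v⟩ = ⟨Cv, (CCᵀ)(c + CCᵀ)⁻¹(Cv)⟩` — «⟨w, Hess²(2+Hess)⁻¹w⟩ = ⟨dw, K(2+K)⁻¹dw⟩». [folklore] -/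
theorem form_hessSq_inv {c : ℝ} (hc : 0 < c) (C : Matrix m n ℝ) (v : n → ℝ) :
    v ⬝ᵥ (((Cᵀ * C) * (Cᵀ * C) * (gramN c C)⁻¹) *ᵥ v) = (C *ᵥ v) ⬝ᵥ (((C * Cᵀ) * (gramM c C)⁻¹) *ᵥ (C *ᵥ v)) := by
  rw [hessSq_mul_inv_eq hc, form_conj]

/-! ### §3 THEOREM B's transport: `4AᵀA ≤ c(c + K)⁻¹` on `ran C` iff `EF ≥ Hess²(c + Hess)⁻¹` -/

omit [DecidableEq m] [DecidableEq n] in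
/-- lens 1's one-step defect form for matrices: `EF(v) = ‖Cv‖² − 4‖ACv‖² = ⟨v, Cᵀ(1 − 4AᵀA)Cv⟩` (file 119's `EFmat` as a form). [folklore] -/
theorem EF_form_eq (A : Matrix k m ℝ) (C : Matrix m n ℝ) (v : n → ℝ) :
    (C *ᵥ v) ⬝ᵥ (C *ᵥ v) - 4 * ((A *ᵥ (C *ᵥ v)) ⬝ᵥ (A *ᵥ (C *ᵥ v)))
      = (C *ᵥ v) ⬝ᵥ (C *ᵥ v) - 4 * ((C *ᵥ v) ⬝ᵥ ((Aᵀ * A) *ᵥ (C *ᵥ v))) := by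
  rw [← Matrix.mulVec_mulVec, Matrix.dotProduct_mulVec (C *ᵥ v) Aᵀ, Matrix.vecMul_transpose]

/-- **TRANSPORT (⇐)**: if `4‖Au‖² ≤ ⟨u, c(c + CCᵀ)⁻¹u⟩` for every `u` (the blocking inequality «4AᵀA ≤ c(c+K)⁻¹», i.e. `≤ g_B(K)` at `c = 2`),
then `⟨v, (CᵀC)²(c + CᵀC)⁻¹v⟩ ≤ ‖Cv‖² − 4‖ACv‖²` for every `v` («EF ≥ Hess²(c+Hess)⁻¹»). [folklore] -/
theorem transportB_of_block {c : ℝ} (hc : 0 < c) (A : Matrix k m ℝ) (C : Matrix m n ℝ)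
    (h : ∀ u : m → ℝ, 4 * ((A *ᵥ u) ⬝ᵥ (A *ᵥ u)) ≤ u ⬝ᵥ ((c • (gramM c C)⁻¹) *ᵥ u)) (v : n → ℝ) :
    v ⬝ᵥ (((Cᵀ * C) * (Cᵀ * C) * (gramN c C)⁻¹) *ᵥ v) ≤ (C *ᵥ v) ⬝ᵥ (C *ᵥ v) - 4 * ((A *ᵥ (C *ᵥ v)) ⬝ᵥ (A *ᵥ (C *ᵥ v))) := by
  rw [form_hessSq_inv hc, ← one_sub_smul_inv_gramM hc, Matrix.sub_mulVec, Matrix.one_mulVec, dotProduct_sub]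
  have hu := h (C *ᵥ v)
  linarith

/-- **TRANSPORT (⇒) on `ran C`**: conversely `EF ≥ Hess²(c+Hess)⁻¹` gives the blocking inequality on every `u = Cv`. [folklore] -/
theorem block_of_transportB {c : ℝ} (hc : 0 < c) (A : Matrix k m ℝ) (C : Matrix m n ℝ)
    (h : ∀ v : n → ℝ, v ⬝ᵥ (((Cᵀ * C) * (Cᵀ * C) * (gramN c C)⁻¹) *ᵥ v) ≤ (C *ᵥ v) ⬝ᵥ (C *ᵥ v) - 4 * ((A *ᵥ (C *ᵥ v)) ⬝ᵥ (A *ᵥ (C *ᵥ v))))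
    (v : n → ℝ) :
    4 * ((A *ᵥ (C *ᵥ v)) ⬝ᵥ (A *ᵥ (C *ᵥ v))) ≤ (C *ᵥ v) ⬝ᵥ ((c • (gramM c C)⁻¹) *ᵥ (C *ᵥ v)) := by
  have hv := h v
  rw [form_hessSq_inv hc, ← one_sub_smul_inv_gramM hc, Matrix.sub_mulVec, Matrix.one_mulVec, dotProduct_sub] at hv
  linarith

/-- **lens 1's THEOREM B EQUIVALENCE, matrix form**: «EF ≥ Hess²(c+Hess)⁻¹ for all v» ⇔ «4AᵀA ≤ c(c+K)⁻¹ on ran C» (`c > 0`; her display is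
`c = 2`: `Hess²(2+Hess)⁻¹` vs `2(2−Δ_plaq)⁻¹`). [folklore] -/
theorem transportB_iff {c : ℝ} (hc : 0 < c) (A : Matrix k m ℝ) (C : Matrix m n ℝ) :
    (∀ v : n → ℝ, v ⬝ᵥ (((Cᵀ * C) * (Cᵀ * C) * (gramN c C)⁻¹) *ᵥ v) ≤ (C *ᵥ v) ⬝ᵥ (C *ᵥ v) - 4 * ((A *ᵥ (C *ᵥ v)) ⬝ᵥ (A *ᵥ (C *ᵥ v))))
      ↔ ∀ v : n → ℝ, 4 * ((A *ᵥ (C *ᵥ v)) ⬝ᵥ (A *ᵥ (C *ᵥ v))) ≤ (C *ᵥ v) ⬝ᵥ ((c • (gramM c C)⁻¹) *ᵥ (C *ᵥ v)) :=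
  ⟨fun h v => block_of_transportB hc A C h v, fun h v => by
    rw [form_hessSq_inv hc, ← one_sub_smul_inv_gramM hc, Matrix.sub_mulVec, Matrix.one_mulVec, dotProduct_sub]
    have hu := h v
    linarith⟩

omit [DecidableEq n] in
/-- the resolvent reading of the right side: `u = c(c + K)⁻¹w` IS the solution of `c·u + K·u = c·w`. [folklore] -/
theorem resolvent_solves {c : ℝ} (hc : 0 < c) (C : Matrix m n ℝ) (w : m → ℝ) :
    c • ((c • (gramM c C)⁻¹) *ᵥ w) + (C * Cᵀ) *ᵥ ((c • (gramM c C)⁻¹) *ᵥ w) = c • w := by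
  have hM := isUnit_det_gramM hc C
  have h : gramM c C * (gramM c C)⁻¹ = 1 := Matrix.mul_nonsing_inv _ hM
  have e : gramM c C *ᵥ ((c • (gramM c C)⁻¹) *ᵥ w) = c • ((c • (gramM c C)⁻¹) *ᵥ w) + (C * Cᵀ) *ᵥ ((c • (gramM c C)⁻¹) *ᵥ w) := by
    conv_lhs => rw [show gramM c C = c • (1 : Matrix m m ℝ) + C * Cᵀ from rfl]
    rw [Matrix.add_mulVec, Matrix.smul_mulVec, Matrix.one_mulVec]
    rfl
  rw [← e, Matrix.mulVec_mulVec, Matrix.mul_smul, h, Matrix.smul_mulVec, Matrix.one_mulVec]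

end Summit.QuantumFields.BalabanUV.T4Continuum.NE7EJResolventTransport

end
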